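import Summits.QuantumAdvantage.QuantumAdvantage.Theorems.SosSandwichTransferPBNodeThresholds
import HarnessLib

/-!
# Crux `TransferPB` (stmt-QuantumAdvantage-15238, route SosSandwich), line `birth` — node-test thresholds: denominator, margins, error polynomial

Support for the last obligation (Q) of stub `stub_pbOracleSimulation` (`nodeProblem F r c k ∈ PromiseBQP`, assembled in
`Theorems/SosSandwichTransferPBNodePromiseBQP.lean`). The read-out layer compares the mean of the block statistic with the rational
threshold `nodeNum/nodeDen₁` up to the oracle-removal error `1/(q+1)`; this file fixes the denominator and the error polynomial and
proves the margin arithmetic: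

* `padOne T = max(T,1)` (truncated-subtraction form, cheap on codes); **`nodeDen₁`** — `80` on MEAN layouts, `16·max(T,1)·W(n)`
  otherwise (`W = ⟦wDenFn⟧ = 1/w`), `nodeDen₁_pos`, **`nodeDen₁C`** (computed on codes for uniform `F`), values on the three layouts;
* `yes_margin`, `no_margin`, `no_margin_zero` — the real inequalities separating `w/4T` (YES) and `w/8T` (NO) from `3w/16T` with
  slack `(T+1)ε` for `ε ≤ w/(16T(T+1))`;
* **`errPoly r c k p = 160 (p+1)² · 2^k (400 (r+1)(2p+1))^c`**, `errPoly_ge_160`, **`margin_le_errPoly`** (`16·max(T,1)·(T+1)·W ≤ q+1`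
  on layouts, `p` a size bound of `F`), `err_le_160`, `err_le_margin`;
* `yes_query_core`, `no_query_core_zero`, `no_query_core_pos` — the threshold inequalities on generalized data.

All proved; definitions explicit (`padOne`, `nodeDen₁`, `errPoly`). No named fact. Sources: S. Aaronson, A. Ambainis, Theory Comput.
10 (2014), proof of Thm. 23 (p. 14); J. Watrous, arXiv:0804.3401, §IV.2 Prop. 3; S. Arora, B. Barak, Computational Complexity (CUP 2009), §1.3.
-/

-- D-0017: single-conjunct summit ⇒ the duplicate `QuantumAdvantage.QuantumAdvantage` is mandated.
set_option linter.dupNamespace false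

noncomputable section

namespace Summit.QuantumAdvantage.QuantumAdvantage.Cruxes.TransferPB.Birth

open Finset Literature.Computability.Cryptography Literature.Computability.Complexity
  Literature.Computability.Complexity.Brick Literature.Computability.Complexity.Plumb
  Literature.Computability.QuantumComplexity Literature.Computability.QuantumComplexity.ClassicalSimulation
  Literature.Computability.Cryptography.ExplicitKWiseHash
open _root_.Computability CodeFP Polynomial

namespace SimTreePB

variable (F : QCircuitFamily cliffordT) (r : Polynomial ℕ) (c k : ℕ)

/-! ### The threshold denominator (positive on every instance) -/

/-- `max(T, 1)` written with truncated subtraction (cheap on codes): `T + (1 − T)`. [folklore] -/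
def padOne (T : ℕ) : ℕ := T + (1 - T)

/-- `padOne T = max T 1`. [folklore] -/
theorem padOne_eq_max (T : ℕ) : padOne T = max T 1 := by unfold padOne; omega

/-- **The threshold denominator**: `80` (MEAN), else `16 · max(T(n),1) · W(n)` (`W = ⟦wDenFn⟧ = 1/w`; the `max` keeps it positive
when `F.circ n` has no oracle gate). [cite: AaronsonAmbainis2014, Thm. 23 (proof, p. 14)] -/
def nodeDen₁ (z : List Bool) : ℕ :=
  if isMeanC F z then 80
  else 16 * padOne (F.circ (nOfLayout z.length)).oracleQueries * bitsToNat (wDenFn F r c k (ones (nOfLayout z.length)))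

/-- The denominator is positive. [folklore] -/
theorem nodeDen₁_pos (z : List Bool) : 0 < nodeDen₁ F r c k z := by
  unfold nodeDen₁
  split_ifs
  · norm_num
  · exact Nat.mul_pos (Nat.mul_pos (by norm_num) (by unfold padOne; omega))
      (wDenFn_pos F r c k (ones (nOfLayout z.length)))

variable {F} in
/-- **The denominator is computed on codes**, for uniform `F`. [cite: AroraBarak2009, §1.3] -/
theorem nodeDen₁C (hF : F.IsUniform) : CodeFP strE natE (nodeDen₁ F r c k) := by
  have cN : CodeFP strE unE (fun z => nOfLayout z.length) := codeFP_nOfLayout.comp strLength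
  have cT : CodeFP strE natE (fun z => (F.circ (nOfLayout z.length)).oracleQueries) :=
    (natOfUn.comp ((codeFP_oracleQueries_un F hF).comp cN)).congr fun _ => id_eq _
  have cOnes : CodeFP strE strE (fun z => ones (nOfLayout z.length)) := (strOfUn.comp cN).congr fun _ => unE_eq_ones _
  have cWd : CodeFP strE strE (fun z => wDenFn F r c k (ones (nOfLayout z.length))) :=
    (of_fn (eα := strE) (eβ := strE) (g := wDenFn F r c k) (wDenFn F r c k) (wDenFn_mem_FP F r c k hF)
      fun a => (congrArg (wDenFn F r c k) (id_eq a)).trans (id_eq _).symm).comp cOnes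
  have cW : CodeFP strE natE (fun z => bitsToNat (wDenFn F r c k (ones (nOfLayout z.length)))) := strVal.comp cWd
  have cT' : CodeFP strE natE (fun z => padOne (F.circ (nOfLayout z.length)).oracleQueries) :=
    (natAdd.comp (cT.pair (natSub.comp ((const _ 1).pair cT)))).congr fun _ => rfl
  -- assembled on opaque pieces (keeps the unifier off the heavy numerals)
  have key : ∀ (Tf Wf : List Bool → ℕ), CodeFP strE natE Tf → CodeFP strE natE Wf →
      CodeFP strE natE (fun z => if isMeanC F z then 80 else 16 * Tf z * Wf z) := fun Tf Wf hT hW =>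
    (isMeanCC hF).ite (const _ 80) (natMul.comp ((natMul.comp ((const _ 16).pair hT)).pair hW))
  exact (key _ _ cT' cW).congr fun z => (nodeDen₁.eq_1 F r c k z).symm

variable (x : List Bool) (ρ : List (Fin (numOracleBits F x) × Bool))

/-- MEAN layouts: denominator `80`. [cite: AaronsonAmbainis2014, Thm. 23 (proof, p. 14)] -/
theorem nodeDen₁_layoutC_encMean (j : ℕ) : nodeDen₁ F r c k (layoutC F (encMean F x ρ j)) = 80 := by
  rw [nodeDen₁, (node_layoutC_encMean F r c k x ρ j).1]; rfl

/-- SINGLE layouts: denominator `16 · max(T,1) · W(|x|)`. [cite: AaronsonAmbainis2014, Thm. 23 (proof, p. 14)] -/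
theorem nodeDen₁_layoutC_encSingle (s : Fin (numOracleBits F x)) :
    nodeDen₁ F r c k (layoutC F (encSingle F x ρ s)) =
      16 * padOne (F.circ x.length).oracleQueries * bitsToNat (wDenFn F r c k (ones x.length)) := by
  rw [nodeDen₁, (node_layoutC_encSingle F r c k x ρ s).1]
  simp only [Bool.false_eq_true, ↓reduceIte]
  rw [show encSingle F x ρ s = boolPair x (boolPair (encPath F x ρ) (false :: true :: bitString F x s)) from rfl, nOfLayout_layoutC]

/-- BLOCK layouts: denominator `16 · max(T,1) · W(|x|)`. [cite: AaronsonAmbainis2014, Thm. 23 (proof, p. 14)] -/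
theorem nodeDen₁_layoutC_encBlock (u : List Bool) :
    nodeDen₁ F r c k (layoutC F (encBlock F x ρ u)) =
      16 * padOne (F.circ x.length).oracleQueries * bitsToNat (wDenFn F r c k (ones x.length)) := by
  rw [nodeDen₁, (node_layoutC_encBlock F r c k x ρ u).1]
  simp only [Bool.false_eq_true, ↓reduceIte]
  rw [show encBlock F x ρ u = boolPair x (boolPair (encPath F x ρ) (false :: false :: u)) from rfl, nOfLayout_layoutC]

/-! ### Arithmetic of the margins -/

/-- YES margin of a magnitude test. [cite: AaronsonAmbainis2014, Thm. 23 (proof, p. 14)] -/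
theorem yes_margin {T W ε M S : ℝ} (hT : 1 ≤ T) (hW : 0 < W) (hε : ε ≤ 1 / (16 * T * (T + 1) * W))
    (hM : 1 / W ≤ M) (hS : M / (4 * T) - T * ε ≤ S) : 3 / (16 * T * W) + ε ≤ S := by
  have hT0 : 0 < T := by linarith
  have h1 : (T + 1) * ε ≤ 1 / (16 * T * W) := by
    calc (T + 1) * ε ≤ (T + 1) * (1 / (16 * T * (T + 1) * W)) := by gcongr
      _ = 1 / (16 * T * W) := by field_simp
  have h2 : (1 / W) / (4 * T) ≤ M / (4 * T) := by gcongr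
  have h3 : 3 / (16 * T * W) + 1 / (16 * T * W) = (1 / W) / (4 * T) := by field_simp; ring
  nlinarith

/-- NO margin of a magnitude test. [cite: AaronsonAmbainis2014, Thm. 23 (proof, p. 14)] -/
theorem no_margin {T W ε M S : ℝ} (hT : 1 ≤ T) (hW : 0 < W) (hε : ε ≤ 1 / (16 * T * (T + 1) * W))
    (hM : M ≤ 1 / W / 2) (hS : S ≤ M / (4 * T) + T * ε) : S ≤ 3 / (16 * T * W) - ε := by
  have hT0 : 0 < T := by linarith
  have h1 : (T + 1) * ε ≤ 1 / (16 * T * W) := by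
    calc (T + 1) * ε ≤ (T + 1) * (1 / (16 * T * (T + 1) * W)) := by gcongr
      _ = 1 / (16 * T * W) := by field_simp
  have h2 : M / (4 * T) ≤ (1 / W / 2) / (4 * T) := by gcongr
  have h3 : (1 / W / 2) / (4 * T) + 1 / (16 * T * W) = 3 / (16 * T * W) := by field_simp; ring
  nlinarith

/-- NO margin when there is no oracle gate (the statistic is empty). [folklore] -/
theorem no_margin_zero {W ε : ℝ} (hW : 0 < W) (hε : ε ≤ 1 / (16 * 1 * (0 + 1) * W)) : (0 : ℝ) ≤ 3 / (16 * 1 * W) - ε := by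
  have h : 1 / (16 * 1 * (0 + 1) * W) ≤ 3 / (16 * 1 * W) := by
    rw [div_le_div_iff₀ (by positivity) (by positivity)]; nlinarith
  linarith

/-! ### The polynomial of the removal error -/

/-- **The error polynomial** `q = 160 (p+1)² · 2^k (400 (r+1)(2p+1))^c`. [cite: AaronsonAmbainis2014, Thm. 23 (proof, p. 14)] -/
def errPoly (p : Polynomial ℕ) : Polynomial ℕ :=
  160 * (p + 1) ^ 2 * (Polynomial.C (2 ^ k) * (Polynomial.C 400 * (r + 1) * (2 * p + 1)) ^ c)

/-- `160 ≤ q + 1`. [folklore] -/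
theorem errPoly_ge_160 (p : Polynomial ℕ) (L : ℕ) : 160 ≤ (errPoly r c k p).eval L + 1 := by
  have h1 : 1 ≤ (p.eval L + 1) ^ 2 := Nat.one_le_pow _ _ (Nat.succ_pos _)
  have h2 : 1 ≤ 2 ^ k * (400 * (r.eval L + 1) * (2 * p.eval L + 1)) ^ c :=
    Nat.mul_pos (Nat.two_pow_pos k) (Nat.pow_pos (by positivity))
  have : 160 * 1 * 1 ≤ 160 * (p.eval L + 1) ^ 2 * (2 ^ k * (400 * (r.eval L + 1) * (2 * p.eval L + 1)) ^ c) :=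
    Nat.mul_le_mul (Nat.mul_le_mul_left _ h1) h2
  simp only [errPoly, eval_mul, eval_pow, eval_add, eval_C, eval_one, eval_ofNat]
  omega

variable {F} in
/-- **The error is below the magnitude margins**: on a layout of `⟨x, w⟩`, `16 · max(T,1) · (T+1) · W(|x|) ≤ q(|z|) + 1`, for a
polynomial `p` bounding the size of `F`. [cite: AaronsonAmbainis2014, Thm. 23 (proof, p. 14)] -/
theorem margin_le_errPoly {p : Polynomial ℕ} (hp : ∀ n, (F.circ n).size ≤ p.eval n ∧ F.ancillas n ≤ p.eval n) (w : List Bool) :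
    16 * padOne (F.circ x.length).oracleQueries * ((F.circ x.length).oracleQueries + 1) * bitsToNat (wDenFn F r c k (ones x.length)) ≤
      (errPoly r c k p).eval (layoutC F (boolPair x w)).length + 1 := by
  set L := (layoutC F (boolPair x w)).length with hL
  have hxL : x.length ≤ L := by rw [hL, length_layoutC_boolPair]; omega
  have hT : (F.circ x.length).oracleQueries ≤ p.eval L :=
    ((List.length_filter_le _ _).trans (hp x.length).1).trans (TM2Iter.eval_mono p hxL)
  have hmax : padOne (F.circ x.length).oracleQueries ≤ p.eval L + 1 := by unfold padOne; omega
  have hlen : (ones x.length).length = x.length := by simp [ones]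
  have hd : thm23Degree F (ones x.length) ≤ 2 * p.eval L + 1 := by
    unfold thm23Degree; rw [hlen]; omega
  have hr : r.eval x.length ≤ r.eval L := TM2Iter.eval_mono r hxL
  have hW : bitsToNat (wDenFn F r c k (ones x.length)) ≤ 2 ^ k * (400 * (r.eval L + 1) * (2 * p.eval L + 1)) ^ c := by
    rw [wDenFn_apply, bitsToNat_encodeNat, hlen]
    refine Nat.mul_le_mul_left _ (Nat.pow_le_pow_left ?_ c)
    calc 400 * ((r.eval x.length + 1) * thm23Degree F (ones x.length))
        ≤ 400 * ((r.eval L + 1) * (2 * p.eval L + 1)) := by gcongr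
      _ = 400 * (r.eval L + 1) * (2 * p.eval L + 1) := by ring
  calc 16 * padOne (F.circ x.length).oracleQueries * ((F.circ x.length).oracleQueries + 1) * bitsToNat (wDenFn F r c k (ones x.length))
      ≤ 16 * (p.eval L + 1) * (p.eval L + 1) * (2 ^ k * (400 * (r.eval L + 1) * (2 * p.eval L + 1)) ^ c) := by
        gcongr
    _ ≤ (errPoly r c k p).eval L + 1 := by
        simp only [errPoly, eval_mul, eval_pow, eval_add, eval_C, eval_one, eval_ofNat]
        nlinarith

/-! ### The removal error against the margins, on layouts -/

/-- The removal error is at most `1/160`. [folklore] -/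
theorem err_le_160 (p : Polynomial ℕ) (L : ℕ) : 1 / ((((errPoly r c k p).eval L : ℕ) : ℝ) + 1) ≤ 1 / 160 := by
  have h : (160 : ℝ) ≤ (((errPoly r c k p).eval L : ℕ) : ℝ) + 1 := by exact_mod_cast errPoly_ge_160 r c k p L
  exact one_div_le_one_div_of_le (by norm_num) h

/-- **The removal error is below the magnitude margin** `1/(16 · max(T,1) · (T+1) · W)` on the layout of `⟨x, w⟩`.
[cite: AaronsonAmbainis2014, Thm. 23 (proof, p. 14)] -/
theorem err_le_margin {p : Polynomial ℕ} (hp : ∀ n, (F.circ n).size ≤ p.eval n ∧ F.ancillas n ≤ p.eval n) (x w : List Bool) :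
    1 / ((((errPoly r c k p).eval (layoutC F (boolPair x w)).length : ℕ) : ℝ) + 1) ≤
      1 / (16 * (padOne (F.circ x.length).oracleQueries : ℝ) * (((F.circ x.length).oracleQueries : ℝ) + 1) *
        (bitsToNat (wDenFn F r c k (ones x.length)) : ℝ)) := by
  have h := margin_le_errPoly r c k x hp w
  have hW := wDenFn_pos F r c k (ones x.length)
  have hP : 0 < padOne (F.circ x.length).oracleQueries := by unfold padOne; omega
  generalize bitsToNat (wDenFn F r c k (ones x.length)) = W at h hW ⊢
  generalize padOne (F.circ x.length).oracleQueries = P₁ at h hP ⊢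
  generalize (F.circ x.length).oracleQueries = T at h ⊢
  generalize (errPoly r c k p).eval (layoutC F (boolPair x w)).length = Q at h ⊢
  have hW' : (0 : ℝ) < W := by exact_mod_cast hW
  have hP' : (0 : ℝ) < P₁ := by exact_mod_cast hP
  refine one_div_le_one_div_of_le (by positivity) ?_
  exact_mod_cast h

/-! ### The six threshold inequalities -/

/-- Core of the YES side of a magnitude test, on generalized data. [cite: AaronsonAmbainis2014, Thm. 23 (proof, p. 14)] -/
theorem yes_query_core (T W Q : ℕ) (S B M : ℝ) (hWpos : (0 : ℝ) < W)
    (hcl : -((T : ℝ) * (1 / ((Q : ℝ) + 1))) ≤ B - S ∧ B - S ≤ (T : ℝ) * (1 / ((Q : ℝ) + 1)))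
    (hε : 1 / ((Q : ℝ) + 1) ≤ 1 / (16 * (padOne T : ℝ) * ((T : ℝ) + 1) * (W : ℝ)))
    (hSP : 4 * (T : ℝ) * S = M) (hyes : 1 / (W : ℝ) ≤ M) :
    ((3 : ℕ) : ℝ) / ((16 * padOne T * W : ℕ) : ℝ) + 1 / ((Q : ℝ) + 1) ≤ B := by
  -- `T ≥ 1`: a magnitude `≥ w > 0` needs an oracle gate
  have hT1 : 1 ≤ T := by
    by_contra h0
    have h0' : (T : ℝ) = 0 := by exact_mod_cast (show T = 0 by omega)
    have hM0 : M = 0 := by rw [← hSP, h0']; ring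
    rw [hM0] at hyes
    exact absurd hyes (not_le.2 (one_div_pos.2 hWpos))
  have hpad : padOne T = T := by unfold padOne; omega
  rw [hpad] at hε ⊢
  push_cast
  refine yes_margin (by exact_mod_cast hT1) hWpos hε hyes ?_
  have hT0 : (0 : ℝ) < T := by exact_mod_cast hT1
  have hS : S = M / (4 * (T : ℝ)) := by rw [← hSP, mul_div_cancel_left₀ _ (ne_of_gt (mul_pos (by norm_num) hT0))]
  rw [hS] at hcl
  linarith [hcl.1]

/-- Core of the NO side of a magnitude test, no oracle gate. [folklore] -/
theorem no_query_core_zero (W Q : ℕ) (B : ℝ) (hWpos : (0 : ℝ) < W)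
    (hcl : B - 0 ≤ ((0 : ℕ) : ℝ) * (1 / ((Q : ℝ) + 1)))
    (hε : 1 / ((Q : ℝ) + 1) ≤ 1 / (16 * (padOne 0 : ℝ) * (((0 : ℕ) : ℝ) + 1) * (W : ℝ))) :
    B ≤ ((3 : ℕ) : ℝ) / ((16 * padOne 0 * W : ℕ) : ℝ) - 1 / ((Q : ℝ) + 1) := by
  have hpad : padOne 0 = 1 := rfl
  rw [hpad] at hε ⊢
  push_cast at hcl hε ⊢
  linarith [no_margin_zero hWpos hε]

/-- Core of the NO side of a magnitude test, at least one oracle gate. [cite: AaronsonAmbainis2014, Thm. 23 (proof, p. 14)] -/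
theorem no_query_core_pos (T W Q : ℕ) (S B M : ℝ) (hT1 : 0 < T) (hWpos : (0 : ℝ) < W)
    (hcl : B - S ≤ (T : ℝ) * (1 / ((Q : ℝ) + 1)))
    (hε : 1 / ((Q : ℝ) + 1) ≤ 1 / (16 * (padOne T : ℝ) * ((T : ℝ) + 1) * (W : ℝ)))
    (hSP : 4 * (T : ℝ) * S = M) (hno : M ≤ 1 / (W : ℝ) / 2) :
    B ≤ ((3 : ℕ) : ℝ) / ((16 * padOne T * W : ℕ) : ℝ) - 1 / ((Q : ℝ) + 1) := by
  have hpad : padOne T = T := by unfold padOne; omega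
  rw [hpad] at hε ⊢
  push_cast
  refine no_margin (by exact_mod_cast hT1) hWpos hε hno ?_
  have hT0 : (0 : ℝ) < T := by exact_mod_cast hT1
  have hS : S = M / (4 * (T : ℝ)) := by rw [← hSP, mul_div_cancel_left₀ _ (ne_of_gt (mul_pos (by norm_num) hT0))]
  rw [hS] at hcl
  linarith

end SimTreePB

end Summit.QuantumAdvantage.QuantumAdvantage.Cruxes.TransferPB.Birth

end
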